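import Summits.CriticalPhenomena.PercolationContinuityZ3.Theorems.PercNearOneGluingNoHeavyLowerTailTIncBernsteinForcing
import Summits.CriticalPhenomena.PercolationContinuityZ3.Theorems.PercNearOneGluingNoHeavyLowerTailThreePointGammaForced
import Mathlib.Tactic.Linarith
import Mathlib.Tactic.LinearCombination
import HarnessLib


/-!
# `NoHeavyLowerTail` (stmt-CriticalPhenomena-4575) — (TB1),(TB2) by fibrewise positivity, IV-b: `CubicThreePointStep.StepHypT V` DISCHARGED
# (prim-e3grp-switch-3's registered step hypothesis, forced-edge vocabulary)

Support file (prover prim-l12-p6 gen 3; `--supports stmt-CriticalPhenomena-4575`).  No definitions, no named facts, no sorries.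
`StepHypT V` (`…CubicThreePointTincInduction`) asks, for every random set `D`, forced set `K`, weights `p ∈ [0,1]`, terminals `a b c` and apex
pair `e = s(x,m)` (`x ≠ m`, `x` forced-joined to `a`), that `threeTB₁, threeTB₂ ≥ 0` at the cells `PrW D p (evZ K a b c)` and the transitions
`PrW D p (evQ K ∩ evU₁ (insert e K))`, … .  Three cases:
* `stepHypT_core` (`e ∉ D ∪ K`): the forcing dictionary (`…TIncBernsteinForcing.PrW_forced`, `ThreePointGamma.evZ_empty`) turns the ten masses
  into the cells of the plain law `PrW (D ∪ K) p_K` and of its `e`-glued law; prove-2's `trans_Q/U₁/U₂/U₃/T` give the transition decomposition;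
  `TIncFibre.threeTB₁/₂_nonneg_of_transitions` (parts I–III: fibrewise positivity of the five-switching certificate of `T_inc`) conclude.
* `stepHypT_of_mem_forced` (`e ∈ K`): all transitions vanish, both pieces are `3·T_inc ≥ 0` (`tincW_nonneg`).
* `stepHypT_of_mem_random` (`e ∈ D ∖ K`): the law is the point `(1−p_e)c⁰ + p_e c¹` of the pencil of `D ∖ e` and the transitions are `(1−p_e)`
  times those of `D ∖ e` (the `e ∈ S` sections are empty), so by de Casteljau both pieces are Bernstein-convex combinations of the pieces of
  `D ∖ e` (main case) and `3·T_inc(c¹) ≥ 0`.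
* **`stepHypT_holds : StepHypT V`** (so `tinc_of_stepHypT hp0 hp1 stepHypT_holds` is a second, induction-based proof of `tincW ≥ 0`).
So prim-e3grp-switch-3's conditional driver p204488 is discharged: the apex-edge induction for `T_inc` runs on every finite weighted graph
(ttrl census l.640, cp-hms TINC-BERNSTEIN.md: 0 violations in 230 M steps — now a theorem).  [this work]
-/

noncomputable section

namespace Summit.CriticalPhenomena.PercolationContinuityZ3.Theorems

namespace TIncFibre

open Finset Literature.Probability.Percolation Literature.Probability.Percolation.DecisionTree
open Literature.Probability.Percolation.Gladkov ThreePointLB TIncSwitching CubicThreePointStep ThreePointGamma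
open Literature.Probability.Percolation.DecisionTree.DTree2 (ins wt1 mem_ins_self_iff)
open scoped Classical

variable {V : Type*} [Fintype V] [DecidableEq V]
/-! ### The step hypothesis -/

section Step

variable {p : Sym2 V → ℝ} (hp0 : ∀ i, 0 ≤ p i) (hp1 : ∀ i, p i ≤ 1)
include hp0 hp1

/-- **Main case `e = s(x,m) ∉ D ∪ K`**: both pieces are nonnegative (parts I–III through the forcing dictionary and prove-2's transition
identities `trans_*`). [this work] -/
theorem stepHypT_core {D K : Finset (Sym2 V)} {a b c x m : V} (hax : ∀ S : Finset (Sym2 V), R K S a x)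
    (heD : s(x, m) ∉ D) (heK : s(x, m) ∉ K) :
    0 ≤ threeTB₁ (PrW D p (evQ K a b c)) (PrW D p (evU₁ K a b c)) (PrW D p (evU₂ K a b c)) (PrW D p (evU₃ K a b c))
        (PrW D p (evT K a b c)) (PrW D p (evQ K a b c ∩ evU₁ (insert s(x, m) K) a b c))
        (PrW D p (evQ K a b c ∩ evU₂ (insert s(x, m) K) a b c)) (PrW D p (evU₁ K a b c ∩ evT (insert s(x, m) K) a b c))
        (PrW D p (evU₂ K a b c ∩ evT (insert s(x, m) K) a b c)) (PrW D p (evU₃ K a b c ∩ evT (insert s(x, m) K) a b c)) ∧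
      0 ≤ threeTB₂ (PrW D p (evQ K a b c)) (PrW D p (evU₁ K a b c)) (PrW D p (evU₂ K a b c)) (PrW D p (evU₃ K a b c))
        (PrW D p (evT K a b c)) (PrW D p (evQ K a b c ∩ evU₁ (insert s(x, m) K) a b c))
        (PrW D p (evQ K a b c ∩ evU₂ (insert s(x, m) K) a b c)) (PrW D p (evU₁ K a b c ∩ evT (insert s(x, m) K) a b c))
        (PrW D p (evU₂ K a b c ∩ evT (insert s(x, m) K) a b c)) (PrW D p (evU₃ K a b c ∩ evT (insert s(x, m) K) a b c)) := by
  set e := s(x, m) with he_def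
  set pK : Sym2 V → ℝ := fun i => if i ∈ K then 1 else p i with hpK
  have hK0 : ∀ i, 0 ≤ pK i := forcedWeights_nonneg hp0 K
  have hK1 : ∀ i, pK i ≤ 1 := forcedWeights_le_one hp1 K
  have heDK : e ∉ D ∪ K := by rw [Finset.mem_union, not_or]; exact ⟨heD, heK⟩
  -- the forcing dictionary for the five cells of `K` and of `insert e K`
  have dQ : PrW D p (evQ K a b c) = PrW (D ∪ K) pK ((conn a b)ᶜ ∩ ((conn a c)ᶜ ∩ (conn b c)ᶜ)) := by
    rw [← evQ_empty, show evQ K a b c = {S | (S ∪ K) ∈ evQ (∅ : Finset (Sym2 V)) a b c} from by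
      ext S; simp only [Set.mem_setOf_eq, mem_evQ, CubicThreePointStep.R, Finset.union_empty]]
    exact PrW_forced K D p _
  have dT : PrW D p (evT K a b c) = PrW (D ∪ K) pK (conn a b ∩ conn a c) := by
    rw [← evT_empty, show evT K a b c = {S | (S ∪ K) ∈ evT (∅ : Finset (Sym2 V)) a b c} from by
      ext S; simp only [Set.mem_setOf_eq, mem_evT, CubicThreePointStep.R, Finset.union_empty]]
    exact PrW_forced K D p _
  have d1 : PrW D p (evU₁ K a b c) = PrW (D ∪ K) pK (conn a b ∩ (conn a c)ᶜ) := by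
    rw [← evU₁_empty, show evU₁ K a b c = {S | (S ∪ K) ∈ evU₁ (∅ : Finset (Sym2 V)) a b c} from by
      ext S; simp only [Set.mem_setOf_eq, mem_evU₁, CubicThreePointStep.R, Finset.union_empty]]
    exact PrW_forced K D p _
  have d2 : PrW D p (evU₂ K a b c) = PrW (D ∪ K) pK (conn a c ∩ (conn a b)ᶜ) := by
    rw [← evU₂_empty, show evU₂ K a b c = {S | (S ∪ K) ∈ evU₂ (∅ : Finset (Sym2 V)) a b c} from by
      ext S; simp only [Set.mem_setOf_eq, mem_evU₂, CubicThreePointStep.R, Finset.union_empty]]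
    exact PrW_forced K D p _
  have d3 : PrW D p (evU₃ K a b c) = PrW (D ∪ K) pK (conn b c ∩ (conn a b)ᶜ) := by
    rw [← evU₃_empty, show evU₃ K a b c = {S | (S ∪ K) ∈ evU₃ (∅ : Finset (Sym2 V)) a b c} from by
      ext S; simp only [Set.mem_setOf_eq, mem_evU₃, CubicThreePointStep.R, Finset.union_empty]]
    exact PrW_forced K D p _
  have gQ : PrW D p (evQ (insert e K) a b c) = PrW (D ∪ K) pK {S | insert e S ∈ ((conn a b)ᶜ ∩ ((conn a c)ᶜ ∩ (conn b c)ᶜ))} := by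
    rw [← evQ_empty, show evQ (insert e K) a b c = {S | (S ∪ K) ∈ {T : Finset (Sym2 V) | insert e T ∈ evQ (∅ : Finset (Sym2 V)) a b c}}
      from by ext S; simp only [Set.mem_setOf_eq, mem_evQ, CubicThreePointStep.R, Finset.union_empty, Finset.union_insert]]
    exact PrW_forced K D p _
  have gT : PrW D p (evT (insert e K) a b c) = PrW (D ∪ K) pK {S | insert e S ∈ (conn a b ∩ conn a c)} := by
    rw [← evT_empty, show evT (insert e K) a b c = {S | (S ∪ K) ∈ {T : Finset (Sym2 V) | insert e T ∈ evT (∅ : Finset (Sym2 V)) a b c}}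
      from by ext S; simp only [Set.mem_setOf_eq, mem_evT, CubicThreePointStep.R, Finset.union_empty, Finset.union_insert]]
    exact PrW_forced K D p _
  have g1 : PrW D p (evU₁ (insert e K) a b c) = PrW (D ∪ K) pK {S | insert e S ∈ (conn a b ∩ (conn a c)ᶜ)} := by
    rw [← evU₁_empty, show evU₁ (insert e K) a b c = {S | (S ∪ K) ∈ {T : Finset (Sym2 V) | insert e T ∈ evU₁ (∅ : Finset (Sym2 V)) a b c}}
      from by ext S; simp only [Set.mem_setOf_eq, mem_evU₁, CubicThreePointStep.R, Finset.union_empty, Finset.union_insert]]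
    exact PrW_forced K D p _
  have g2 : PrW D p (evU₂ (insert e K) a b c) = PrW (D ∪ K) pK {S | insert e S ∈ (conn a c ∩ (conn a b)ᶜ)} := by
    rw [← evU₂_empty, show evU₂ (insert e K) a b c = {S | (S ∪ K) ∈ {T : Finset (Sym2 V) | insert e T ∈ evU₂ (∅ : Finset (Sym2 V)) a b c}}
      from by ext S; simp only [Set.mem_setOf_eq, mem_evU₂, CubicThreePointStep.R, Finset.union_empty, Finset.union_insert]]
    exact PrW_forced K D p _
  have g3 : PrW D p (evU₃ (insert e K) a b c) = PrW (D ∪ K) pK {S | insert e S ∈ (conn b c ∩ (conn a b)ᶜ)} := by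
    rw [← evU₃_empty, show evU₃ (insert e K) a b c = {S | (S ∪ K) ∈ {T : Finset (Sym2 V) | insert e T ∈ evU₃ (∅ : Finset (Sym2 V)) a b c}}
      from by ext S; simp only [Set.mem_setOf_eq, mem_evU₃, CubicThreePointStep.R, Finset.union_empty, Finset.union_insert]]
    exact PrW_forced K D p _
  -- prove-2's transition identities at `(D, p, K)`
  have tQ := trans_Q D p (K := K) (b := b) (c := c) (m := m) hax
  have t1 := trans_U₁ D p (K := K) (a := a) (b := b) (c := c) (x := x) (m := m)
  have t2 := trans_U₂ D p (K := K) (a := a) (b := b) (c := c) (x := x) (m := m)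
  have t3 := trans_U₃ D p (K := K) (b := b) (c := c) (m := m) hax
  have tT := trans_T D p (K := K) (b := b) (c := c) (m := m) hax
  rw [gQ, dQ] at tQ
  rw [g1, d1] at t1
  rw [g2, d2] at t2
  rw [g3, d3] at t3
  rw [gT, dT] at tT
  rw [dQ, dT, d1, d2, d3]
  refine ⟨threeTB₁_nonneg_of_transitions hK0 hK1 (D ∪ K) a b c heDK (by linarith) (by linarith) (by linarith) (by linarith)
      (by linarith), threeTB₂_nonneg_of_transitions hK0 hK1 (D ∪ K) a b c heDK (by linarith) (by linarith) (by linarith)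
      (by linarith) (by linarith)⟩

/-- **Case `e ∈ K`** (the apex pair already forced): all transitions vanish and both pieces equal `3·T_inc ≥ 0`. [this work] -/
theorem stepHypT_of_mem_forced {D K : Finset (Sym2 V)} {a b c x m : V} (heK : s(x, m) ∈ K) :
    0 ≤ threeTB₁ (PrW D p (evQ K a b c)) (PrW D p (evU₁ K a b c)) (PrW D p (evU₂ K a b c)) (PrW D p (evU₃ K a b c))
        (PrW D p (evT K a b c)) (PrW D p (evQ K a b c ∩ evU₁ (insert s(x, m) K) a b c))
        (PrW D p (evQ K a b c ∩ evU₂ (insert s(x, m) K) a b c)) (PrW D p (evU₁ K a b c ∩ evT (insert s(x, m) K) a b c))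
        (PrW D p (evU₂ K a b c ∩ evT (insert s(x, m) K) a b c)) (PrW D p (evU₃ K a b c ∩ evT (insert s(x, m) K) a b c)) ∧
      0 ≤ threeTB₂ (PrW D p (evQ K a b c)) (PrW D p (evU₁ K a b c)) (PrW D p (evU₂ K a b c)) (PrW D p (evU₃ K a b c))
        (PrW D p (evT K a b c)) (PrW D p (evQ K a b c ∩ evU₁ (insert s(x, m) K) a b c))
        (PrW D p (evQ K a b c ∩ evU₂ (insert s(x, m) K) a b c)) (PrW D p (evU₁ K a b c ∩ evT (insert s(x, m) K) a b c))
        (PrW D p (evU₂ K a b c ∩ evT (insert s(x, m) K) a b c)) (PrW D p (evU₃ K a b c ∩ evT (insert s(x, m) K) a b c)) := by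
  have hK : insert s(x, m) K = K := Finset.insert_eq_of_mem heK
  rw [hK]
  have z1 : PrW D p (evQ K a b c ∩ evU₁ K a b c) = 0 :=
    PrW_eq_zero_of_forall D p fun S _ h => h.1.1 h.2.1
  have z2 : PrW D p (evQ K a b c ∩ evU₂ K a b c) = 0 :=
    PrW_eq_zero_of_forall D p fun S _ h => h.1.2.1 h.2.1
  have z3 : PrW D p (evU₁ K a b c ∩ evT K a b c) = 0 :=
    PrW_eq_zero_of_forall D p fun S _ h => h.1.2 h.2.2
  have z4 : PrW D p (evU₂ K a b c ∩ evT K a b c) = 0 :=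
    PrW_eq_zero_of_forall D p fun S _ h => h.1.2 h.2.1
  have z5 : PrW D p (evU₃ K a b c ∩ evT K a b c) = 0 :=
    PrW_eq_zero_of_forall D p fun S _ h => h.1.2 h.2.1
  rw [z1, z2, z3, z4, z5, threeTB₁_zero, threeTB₂_zero]
  have h := tincW_nonneg hp0 hp1 D K a b c
  unfold tincW at h
  constructor <;> linarith

/-- **Case `e ∈ D ∖ K`** (the apex pair is random): the law is the point `(1−p_e)c⁰ + p_e c¹` of the pencil of `D ∖ e`, its transition masses are
`(1−p_e)`-times those of `D ∖ e`, and by de Casteljau the pieces are Bernstein-convex combinations of the pieces of `D ∖ e` and of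
`3·T_inc(c¹) ≥ 0`. [this work] -/
theorem stepHypT_of_mem_random {D K : Finset (Sym2 V)} {a b c x m : V} (hax : ∀ S : Finset (Sym2 V), R K S a x)
    (heD : s(x, m) ∈ D) (heK : s(x, m) ∉ K) :
    0 ≤ threeTB₁ (PrW D p (evQ K a b c)) (PrW D p (evU₁ K a b c)) (PrW D p (evU₂ K a b c)) (PrW D p (evU₃ K a b c))
        (PrW D p (evT K a b c)) (PrW D p (evQ K a b c ∩ evU₁ (insert s(x, m) K) a b c))
        (PrW D p (evQ K a b c ∩ evU₂ (insert s(x, m) K) a b c)) (PrW D p (evU₁ K a b c ∩ evT (insert s(x, m) K) a b c))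
        (PrW D p (evU₂ K a b c ∩ evT (insert s(x, m) K) a b c)) (PrW D p (evU₃ K a b c ∩ evT (insert s(x, m) K) a b c)) ∧
      0 ≤ threeTB₂ (PrW D p (evQ K a b c)) (PrW D p (evU₁ K a b c)) (PrW D p (evU₂ K a b c)) (PrW D p (evU₃ K a b c))
        (PrW D p (evT K a b c)) (PrW D p (evQ K a b c ∩ evU₁ (insert s(x, m) K) a b c))
        (PrW D p (evQ K a b c ∩ evU₂ (insert s(x, m) K) a b c)) (PrW D p (evU₁ K a b c ∩ evT (insert s(x, m) K) a b c))
        (PrW D p (evU₂ K a b c ∩ evT (insert s(x, m) K) a b c)) (PrW D p (evU₃ K a b c ∩ evT (insert s(x, m) K) a b c)) := by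
  set e := s(x, m) with he_def
  set D' := D.erase e with hD'
  have heD' : e ∉ D' := Finset.notMem_erase e D
  have hD : D = insert e D' := (Finset.insert_erase heD).symm
  -- cells split along `e`
  have sq : PrW D p (evQ K a b c) = (1 - p e) * PrW D' p (evQ K a b c) + p e * PrW D' p (evQ (insert e K) a b c) := by
    rw [hD, CubicThreePointStep.PrW_split D' p heD', sect_evQ]
  have s1 : PrW D p (evU₁ K a b c) = (1 - p e) * PrW D' p (evU₁ K a b c) + p e * PrW D' p (evU₁ (insert e K) a b c) := by
    rw [hD, CubicThreePointStep.PrW_split D' p heD', sect_evU₁]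
  have s2 : PrW D p (evU₂ K a b c) = (1 - p e) * PrW D' p (evU₂ K a b c) + p e * PrW D' p (evU₂ (insert e K) a b c) := by
    rw [hD, CubicThreePointStep.PrW_split D' p heD', sect_evU₂]
  have s3 : PrW D p (evU₃ K a b c) = (1 - p e) * PrW D' p (evU₃ K a b c) + p e * PrW D' p (evU₃ (insert e K) a b c) := by
    rw [hD, CubicThreePointStep.PrW_split D' p heD', sect_evU₃]
  have sT : PrW D p (evT K a b c) = (1 - p e) * PrW D' p (evT K a b c) + p e * PrW D' p (evT (insert e K) a b c) := by
    rw [hD, CubicThreePointStep.PrW_split D' p heD', sect_evT]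
  -- transition cells: the `e ∈ S` sections are empty (`e` open contradicts a change of type caused by forcing `e`)
  have hRR : ∀ (u v : V) (S : Finset (Sym2 V)),
      CubicThreePointStep.R (insert e K) (insert e S) u v ↔ CubicThreePointStep.R K (insert e S) u v := by
    intro u v S; rw [R_insert_config_iff, R_insert_config_iff, Finset.insert_idem]
  have z1 : PrW D' p {S | insert e S ∈ evQ K a b c ∩ evU₁ (insert e K) a b c} = 0 :=
    PrW_eq_zero_of_forall D' p fun S _ h => h.1.1 ((hRR a b S).1 h.2.1)
  have z2 : PrW D' p {S | insert e S ∈ evQ K a b c ∩ evU₂ (insert e K) a b c} = 0 :=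
    PrW_eq_zero_of_forall D' p fun S _ h => h.1.2.1 ((hRR a c S).1 h.2.1)
  have z3 : PrW D' p {S | insert e S ∈ evU₁ K a b c ∩ evT (insert e K) a b c} = 0 :=
    PrW_eq_zero_of_forall D' p fun S _ h => h.1.2 ((hRR a c S).1 h.2.2)
  have z4 : PrW D' p {S | insert e S ∈ evU₂ K a b c ∩ evT (insert e K) a b c} = 0 :=
    PrW_eq_zero_of_forall D' p fun S _ h => h.1.2 ((hRR a b S).1 h.2.1)
  have z5 : PrW D' p {S | insert e S ∈ evU₃ K a b c ∩ evT (insert e K) a b c} = 0 :=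
    PrW_eq_zero_of_forall D' p fun S _ h => h.1.2 ((hRR a b S).1 h.2.1)
  have r1 : PrW D p (evQ K a b c ∩ evU₁ (insert e K) a b c) = (1 - p e) * PrW D' p (evQ K a b c ∩ evU₁ (insert e K) a b c) := by
    rw [hD, CubicThreePointStep.PrW_split D' p heD', z1]; ring
  have r2 : PrW D p (evQ K a b c ∩ evU₂ (insert e K) a b c) = (1 - p e) * PrW D' p (evQ K a b c ∩ evU₂ (insert e K) a b c) := by
    rw [hD, CubicThreePointStep.PrW_split D' p heD', z2]; ring
  have r3 : PrW D p (evU₁ K a b c ∩ evT (insert e K) a b c) = (1 - p e) * PrW D' p (evU₁ K a b c ∩ evT (insert e K) a b c) := by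
    rw [hD, CubicThreePointStep.PrW_split D' p heD', z3]; ring
  have r4 : PrW D p (evU₂ K a b c ∩ evT (insert e K) a b c) = (1 - p e) * PrW D' p (evU₂ K a b c ∩ evT (insert e K) a b c) := by
    rw [hD, CubicThreePointStep.PrW_split D' p heD', z4]; ring
  have r5 : PrW D p (evU₃ K a b c ∩ evT (insert e K) a b c) = (1 - p e) * PrW D' p (evU₃ K a b c ∩ evT (insert e K) a b c) := by
    rw [hD, CubicThreePointStep.PrW_split D' p heD', z5]; ring
  -- the pencil of `D'`: glued cells = cells + transitions (prove-2's identities at `D'`)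
  have tQ := trans_Q D' p (K := K) (b := b) (c := c) (m := m) hax
  have t1 := trans_U₁ D' p (K := K) (a := a) (b := b) (c := c) (x := x) (m := m)
  have t2 := trans_U₂ D' p (K := K) (a := a) (b := b) (c := c) (x := x) (m := m)
  have t3 := trans_U₃ D' p (K := K) (b := b) (c := c) (m := m) hax
  have tT := trans_T D' p (K := K) (b := b) (c := c) (m := m) hax
  set q := PrW D' p (evQ K a b c)
  set u₁ := PrW D' p (evU₁ K a b c)
  set u₂ := PrW D' p (evU₂ K a b c)
  set u₃ := PrW D' p (evU₃ K a b c)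
  set t := PrW D' p (evT K a b c)
  set α₁ := PrW D' p (evQ K a b c ∩ evU₁ (insert e K) a b c)
  set α₂ := PrW D' p (evQ K a b c ∩ evU₂ (insert e K) a b c)
  set β₁ := PrW D' p (evU₁ K a b c ∩ evT (insert e K) a b c)
  set β₂ := PrW D' p (evU₂ K a b c ∩ evT (insert e K) a b c)
  set β₃ := PrW D' p (evU₃ K a b c ∩ evT (insert e K) a b c)
  have hq1 : PrW D' p (evQ (insert e K) a b c) = q - α₁ - α₂ := by linarith
  have hu1 : PrW D' p (evU₁ (insert e K) a b c) = u₁ + α₁ - β₁ := by linarith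
  have hu2 : PrW D' p (evU₂ (insert e K) a b c) = u₂ + α₂ - β₂ := by linarith
  have hu3 : PrW D' p (evU₃ (insert e K) a b c) = u₃ - β₃ := by linarith
  have ht1 : PrW D' p (evT (insert e K) a b c) = t + β₁ + β₂ + β₃ := by linarith
  rw [sq, s1, s2, s3, sT, r1, r2, r3, r4, r5, hq1, hu1, hu2, hu3, ht1]
  set s := p e with hs
  have e1 : (1 - s) * q + s * (q - α₁ - α₂) = q + s * (-α₁ - α₂) := by ring
  have e2 : (1 - s) * u₁ + s * (u₁ + α₁ - β₁) = u₁ + s * (α₁ - β₁) := by ring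
  have e3 : (1 - s) * u₂ + s * (u₂ + α₂ - β₂) = u₂ + s * (α₂ - β₂) := by ring
  have e4 : (1 - s) * u₃ + s * (u₃ - β₃) = u₃ + s * (-β₃) := by ring
  have e5 : (1 - s) * t + s * (t + β₁ + β₂ + β₃) = t + s * (β₁ + β₂ + β₃) := by ring
  rw [e1, e2, e3, e4, e5, threeTB₁_deCasteljau, threeTB₂_deCasteljau]
  -- the pieces of `D'` (main case) and `T_inc` at the glued law of `D'`
  obtain ⟨hB1, hB2⟩ := stepHypT_core hp0 hp1 (D := D') (K := K) (a := a) (b := b) (c := c) (x := x) (m := m) hax heD' heK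
  have hT1 : 0 ≤ Tinc (q - α₁ - α₂) (u₁ + α₁ - β₁) (u₂ + α₂ - β₂) (u₃ - β₃) (t + β₁ + β₂ + β₃) := by
    have h := tincW_nonneg hp0 hp1 D' (insert e K) a b c
    unfold tincW at h
    rwa [hq1, hu1, hu2, hu3, ht1] at h
  have hs0 : 0 ≤ s := hp0 e
  have hs1 : 0 ≤ 1 - s := sub_nonneg.2 (hp1 e)
  refine ⟨?_, ?_⟩
  · have h1 : 0 ≤ (1 - s) ^ 2 * threeTB₁ q u₁ u₂ u₃ t α₁ α₂ β₁ β₂ β₃ := mul_nonneg (pow_nonneg hs1 2) hB1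
    have h2 : 0 ≤ 2 * s * (1 - s) * threeTB₂ q u₁ u₂ u₃ t α₁ α₂ β₁ β₂ β₃ :=
      mul_nonneg (mul_nonneg (mul_nonneg (by norm_num) hs0) hs1) hB2
    have h3 : 0 ≤ 3 * s ^ 2 * Tinc (q - α₁ - α₂) (u₁ + α₁ - β₁) (u₂ + α₂ - β₂) (u₃ - β₃) (t + β₁ + β₂ + β₃) :=
      mul_nonneg (mul_nonneg (by norm_num) (pow_nonneg hs0 2)) hT1
    linarith
  · have h2 : 0 ≤ (1 - s) * threeTB₂ q u₁ u₂ u₃ t α₁ α₂ β₁ β₂ β₃ := mul_nonneg hs1 hB2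
    have h3 : 0 ≤ 3 * s * Tinc (q - α₁ - α₂) (u₁ + α₁ - β₁) (u₂ + α₂ - β₂) (u₃ - β₃) (t + β₁ + β₂ + β₃) :=
      mul_nonneg (mul_nonneg (by norm_num) hs0) hT1
    linarith

omit hp0 hp1 in
/-- **`StepHypT V` holds** (prim-e3grp-switch-3's hypothesis (TB1),(TB2), `…CubicThreePointTincInduction`): for every random set `D`, forced
set `K`, weights `p ∈ [0,1]`, terminals `a b c` and apex pair `{x,m}` with `x` forced-joined to `a`, both Bernstein pieces of `T_inc` are `≥ 0`.
Proof: fibrewise positivity of the `T_inc` certificate (parts I–III) + the forcing dictionary + de Casteljau. [this work] -/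
theorem stepHypT_holds : StepHypT V := by
  intro D K p hp0 hp1 a b c x m hxm hax
  by_cases heK : s(x, m) ∈ K
  · exact stepHypT_of_mem_forced hp0 hp1 heK
  by_cases heD : s(x, m) ∈ D
  · exact stepHypT_of_mem_random hp0 hp1 hax heD heK
  · exact stepHypT_core hp0 hp1 hax heD heK

end Step

end TIncFibre

end Summit.CriticalPhenomena.PercolationContinuityZ3.Theorems

end
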